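import Summits.CriticalPhenomena.PercolationContinuityZ3.Theorems.PercNearOneGluingNoHeavyLowerTailSahiCTCRtThreeRowOneProfile
import Summits.CriticalPhenomena.PercolationContinuityZ3.Theorems.PercNearOneGluingNoHeavyLowerTailSahiCTCRtThreeHybridReduction
import HarnessLib

/-!
# `NoHeavyLowerTail` (crux stmt-CriticalPhenomena-4575), P3 lane: ROW 1 OF `R_3 ∈ ℕ[s]` ON THE SMALL SUPPORTS, AND FOR EVERY PROFILE

Support file (seat `prim-l12-p3`, gen 51; `--supports stmt-CriticalPhenomena-4575`; `--computational`: one `native_decide` over the quadruples of families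
on `Fin 2`, `full_two_nonneg`).  Memo `run/shared/lean/prim/prim-l12/FROM-prim-l12-p3-g51-ROW0-ALL-K-LEAN.md` §5.
* `indPair_map`, `pullGen_bySize/below/inter/sdiff_union` : transport of indicator pair sums / pull-backs along any injection `β ↪ α`;
* `coeff_rowOne_ge_full` : `B_1 ≥` the full Kleitman atom sums on `σ` + pivot pairs (`< 3` points) − window pairs + crossing pairs (any `σ ∌ d`, up-sets);
* `full_two_nonneg` (`Fin 2`, `native_decide`; `synthInstance` limits raised for the decidability instance), `coeff_ind_add_single_two_Rt_three_nonneg_two` (`#σ = 2`);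
* **`coeff_ind_add_single_two_Rt_three_nonneg_all`** : ROW 1 for EVERY `σ ∌ d` (up-sets, `σ` loop-free): `#σ ≥ 3` is `…RowOne`, `#σ = 2` the two-point check,
  `#σ ≤ 1` vanishes (`coeff_Rt_three_eq_zero_of_card_support_le_two`), `∅ ∈ 𝒳` gives `R_3 = 0`;
* **`coeff_Rt_three_nonneg_of_card_dbl_eq_one'`** : the COMPLETE `#dbl n = 1` case of `hLF` of `coeff_Rt_three_nonneg_of_loopFree'`.
With `…RtThreeRowZero.coeff_Rt_three_nonneg_of_card_dbl_eq_zero` (gen 51) the rows `#dbl ≤ 1` of the open core are tree theorems; `#dbl = 2` remains.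
No new definitions; nothing is asserted about the crux.
-/

namespace Summit.CriticalPhenomena.PercolationContinuityZ3.Theorems.SahiCTCForms

open Finset MvPolynomial SahiCTCGenFun

/-! ## ROW 1 on the supports with at most two single points -/

namespace RtThreeFin3

open SahiCTCGenFun

section PullGen
variable {α β : Type*} [DecidableEq α] [Fintype α] [DecidableEq β] [Fintype β] (φ : β ↪ α)

omit [Fintype α] in
/-- Transport of a double indicator sum along an injection. [this work] -/
theorem indPair_map (A B : Finset (Finset α)) :
    ∑ P ∈ ((univ : Finset β).map φ).powerset, ∑ P' ∈ ((univ : Finset β).map φ).powerset, ιq A P * ιq B P' * (if Disjoint P P' then (1 : ℚ) else 0) =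
      ∑ P ∈ (univ : Finset β).powerset, ∑ P' ∈ (univ : Finset β).powerset,
        ιq ((univ : Finset β).powerset.filter fun T => T.map φ ∈ A) P * ιq ((univ : Finset β).powerset.filter fun T => T.map φ ∈ B) P' * (if Disjoint P P' then (1 : ℚ) else 0) := by
  rw [sum_powerset_map]
  refine sum_congr rfl fun P hP => ?_
  rw [sum_powerset_map]
  refine sum_congr rfl fun P' hP' => ?_
  have hd : (if Disjoint (P.map φ) (P'.map φ) then (1 : ℚ) else 0) = (if Disjoint P P' then 1 else 0) := by
    by_cases h : Disjoint P P'
    · rw [if_pos h, if_pos ((disjoint_map φ).2 h)]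
    · rw [if_neg h, if_neg (fun h' => h ((disjoint_map φ).1 h'))]
  rw [ιq_map φ A (mem_powerset.1 hP), ιq_map φ B (mem_powerset.1 hP'), hd]

omit [DecidableEq β] in
/-- Pull-back of `Θ_j` along an injection. [this work] -/
theorem pullGen_bySize (j : ℕ) : ((univ : Finset β).powerset.filter fun T => T.map φ ∈ (bySize (· < j) : Finset (Finset α))) = (bySize (· < j) : Finset (Finset β)) := by
  ext T; simp only [bySize, mem_filter, mem_powerset, subset_univ, true_and, card_map]

omit [Fintype α] [DecidableEq β] in
/-- Pull-back of `K_{<j}` along an injection. [this work] -/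
theorem pullGen_below (j : ℕ) (K : Finset (Finset α)) : ((univ : Finset β).powerset.filter fun T => T.map φ ∈ (below j K)) = below j ((univ : Finset β).powerset.filter fun T => T.map φ ∈ K) := by
  ext T; simp only [below, mem_filter, mem_powerset, subset_univ, true_and, card_map]

omit [Fintype α] in
/-- Pull-back of an intersection along an injection. [this work] -/
theorem pullGen_inter (K L : Finset (Finset α)) : ((univ : Finset β).powerset.filter fun T => T.map φ ∈ (K ∩ L)) = ((univ : Finset β).powerset.filter fun T => T.map φ ∈ K) ∩ ((univ : Finset β).powerset.filter fun T => T.map φ ∈ L) := by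
  ext T; simp only [mem_filter, mem_inter, mem_powerset, subset_univ, true_and]

omit [Fintype α] in
/-- Pull-back of `K ∖ (L ∪ L')` along an injection. [this work] -/
theorem pullGen_sdiff_union (K L L' : Finset (Finset α)) :
    ((univ : Finset β).powerset.filter fun T => T.map φ ∈ (K \ (L ∪ L'))) = ((univ : Finset β).powerset.filter fun T => T.map φ ∈ K) \ (((univ : Finset β).powerset.filter fun T => T.map φ ∈ L) ∪ ((univ : Finset β).powerset.filter fun T => T.map φ ∈ L')) := by
  ext T; simp only [mem_filter, mem_sdiff, mem_union, mem_powerset, subset_univ, true_and, not_or]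

end PullGen

/-- **Lower bound for the row with one doubled point on ANY `σ ∌ d`** (up-sets): `B_1 ≥` the three full Kleitman atom sums on `σ` plus the pivot pairs with a
pivot set of `< 3` points minus the window pairs plus the crossing pairs, all written as double indicator sums over the subsets of `σ`. [this work] -/
theorem coeff_rowOne_ge_full {α : Type*} [DecidableEq α] [Fintype α] {F G : Finset (Finset α)} (hF : IsUpperSet (F : Set (Finset α)))
    (hG : IsUpperSet (G : Set (Finset α))) {σ : Finset α} {d : α} (hd : d ∉ σ) :
    atomSum (fun a b c => ∑ t ∈ range 3, (((#σ - a - b - c).choose t : ℕ) : ℚ) *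
          (if b + c < #σ - t then ((((#σ - t : ℕ) : ℚ)) * ((((#σ - t - 1).choose (b + c) : ℕ) : ℚ)))⁻¹ else 0))
        (fun _ _ _ => 0) (fun _ _ _ => 0) (fun _ _ _ => 0) (fun _ _ _ => 0) (linkV d F) (linkV d G) σ
      + atomSum (fun a b c => ∑ t ∈ range 2, (((#σ - a - b - c).choose t : ℕ) : ℚ) *
          (if b + c < #σ - t then ((((#σ - t : ℕ) : ℚ)) * ((((#σ - t - 1).choose (b + c) : ℕ) : ℚ)))⁻¹ else 0))
        (fun _ _ _ => 0) (fun _ _ _ => 0) (fun _ _ _ => 0) (fun _ _ _ => 0) (delV d F) (linkV d G) σ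
      + atomSum (fun a b c => ∑ t ∈ range 2, (((#σ - a - b - c).choose t : ℕ) : ℚ) *
          (if b + c < #σ - t then ((((#σ - t : ℕ) : ℚ)) * ((((#σ - t - 1).choose (b + c) : ℕ) : ℚ)))⁻¹ else 0))
        (fun _ _ _ => 0) (fun _ _ _ => 0) (fun _ _ _ => 0) (fun _ _ _ => 0) (linkV d F) (delV d G) σ
      + (∑ P ∈ σ.powerset, ∑ P' ∈ σ.powerset, ιq (bySize (· < 2) : Finset (Finset α)) P * ιq (below 3 (((linkV d F) ∩ (linkV d G)) \ ((delV d F) ∪ (delV d G)))) P' * (if Disjoint P P' then (1 : ℚ) else 0))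
      - (∑ P ∈ σ.powerset, ∑ P' ∈ σ.powerset, ιq (bySize (· < 3) : Finset (Finset α)) P * ιq (below 2 ((linkV d F) ∩ (linkV d G))) P' * (if Disjoint P P' then (1 : ℚ) else 0))
      - (∑ P ∈ σ.powerset, ∑ P' ∈ σ.powerset, ιq (bySize (· < 2) : Finset (Finset α)) P * ιq (below 3 ((delV d F) ∩ (delV d G))) P' * (if Disjoint P P' then (1 : ℚ) else 0))
      - (∑ P ∈ σ.powerset, ∑ P' ∈ σ.powerset, ιq (bySize (· < 2) : Finset (Finset α)) P * ιq (below 2 ((linkV d F) ∩ (linkV d G))) P' * (if Disjoint P P' then (1 : ℚ) else 0))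
      + (∑ P ∈ σ.powerset, ∑ P' ∈ σ.powerset, ιq (below 2 (linkV d F)) P * ιq (below 3 (delV d G)) P' * (if Disjoint P P' then (1 : ℚ) else 0))
      + (∑ P ∈ σ.powerset, ∑ P' ∈ σ.powerset, ιq (below 3 (delV d F)) P * ιq (below 2 (linkV d G)) P' * (if Disjoint P P' then (1 : ℚ) else 0))
      + (∑ P ∈ σ.powerset, ∑ P' ∈ σ.powerset, ιq (below 2 (linkV d F)) P * ιq (below 2 (linkV d G)) P' * (if Disjoint P P' then (1 : ℚ) else 0))
      ≤ (((Rt 3 F G).coeff (ind σ + Finsupp.single d 2) : ℤ) : ℚ) := by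
  rw [coeff_ind_add_single_two_Rt_three_eq_atomSums F G hd, coeff_ie_eq_pairsAt hF hG d σ, coeff_theta_PiP_gf,
    show gf (bySize (· < 2) : Finset (Finset α)) * (PiP * (gf (below 3 (delV d F ∩ delV d G)) + gf (below 2 (linkV d F ∩ linkV d G))))
        = gf (bySize (· < 2) : Finset (Finset α)) * (PiP * gf (below 3 (delV d F ∩ delV d G)))
          + gf (bySize (· < 2) : Finset (Finset α)) * (PiP * gf (below 2 (linkV d F ∩ linkV d G))) by ring,
    coeff_add, coeff_theta_PiP_gf, coeff_theta_PiP_gf]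
  push_cast
  simp only [sum_add_distrib, sum_pairsAt_eq_sum_ind]
  have hbig : (0 : ℚ) ≤ ∑ P ∈ σ.powerset, ∑ P' ∈ σ.powerset,
      ιq (bySize (· < 2) : Finset (Finset α)) P * ιq (atLeast 3 ((linkV d F ∩ linkV d G) \ (delV d F ∪ delV d G))) P' *
        (if Disjoint P P' then (1 : ℚ) else 0) :=
    sum_nonneg fun P _ => sum_nonneg fun P' _ => by unfold ιq; split_ifs <;> norm_num
  linarith [hbig]

set_option synthInstance.maxHeartbeats 400000 in
set_option synthInstance.maxSize 4096 in
/-- **THE TWO-POINT CHECK** (`σ` itself is the window): for admissible trace data on `Fin 2` the full quantity of `coeff_rowOne_ge_full` at `#σ = 2` is `≥ 0`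
(one `native_decide` over all quadruples of families on `Fin 2`). [this work] -/
theorem full_two_nonneg : ∀ X0 X1 Z0 Z1 : Finset (Finset (Fin 2)),
    (∀ S ∈ X1, ∀ i : Fin 2, insert i S ∈ X1) → (∀ S ∈ X0, ∀ i : Fin 2, insert i S ∈ X0) →
    (∀ S ∈ X0, S ∈ X1) → (∀ S ∈ X0, 2 ≤ #S) →
    (∀ S ∈ Z1, ∀ i : Fin 2, insert i S ∈ Z1) → (∀ S ∈ Z0, ∀ i : Fin 2, insert i S ∈ Z0) →
    (∀ S ∈ Z0, S ∈ Z1) → (∀ S ∈ Z0, 2 ≤ #S) →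
    0 ≤ atomSum (fun a b c => ∑ t ∈ range 3, (((2 - a - b - c).choose t : ℕ) : ℚ) *
          (if b + c < 2 - t then ((((2 - t : ℕ) : ℚ)) * ((((2 - t - 1).choose (b + c) : ℕ) : ℚ)))⁻¹ else 0))
        (fun _ _ _ => 0) (fun _ _ _ => 0) (fun _ _ _ => 0) (fun _ _ _ => 0) X1 Z1 (univ : Finset (Fin 2))
      + atomSum (fun a b c => ∑ t ∈ range 2, (((2 - a - b - c).choose t : ℕ) : ℚ) *
          (if b + c < 2 - t then ((((2 - t : ℕ) : ℚ)) * ((((2 - t - 1).choose (b + c) : ℕ) : ℚ)))⁻¹ else 0))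
        (fun _ _ _ => 0) (fun _ _ _ => 0) (fun _ _ _ => 0) (fun _ _ _ => 0) X0 Z1 (univ : Finset (Fin 2))
      + atomSum (fun a b c => ∑ t ∈ range 2, (((2 - a - b - c).choose t : ℕ) : ℚ) *
          (if b + c < 2 - t then ((((2 - t : ℕ) : ℚ)) * ((((2 - t - 1).choose (b + c) : ℕ) : ℚ)))⁻¹ else 0))
        (fun _ _ _ => 0) (fun _ _ _ => 0) (fun _ _ _ => 0) (fun _ _ _ => 0) X1 Z0 (univ : Finset (Fin 2))
      + (∑ P ∈ (univ : Finset (Fin 2)).powerset, ∑ P' ∈ (univ : Finset (Fin 2)).powerset, ιq (bySize (· < 2) : Finset (Finset (Fin 2))) P * ιq (below 3 ((X1 ∩ Z1) \ (X0 ∪ Z0))) P' * (if Disjoint P P' then (1 : ℚ) else 0))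
      - (∑ P ∈ (univ : Finset (Fin 2)).powerset, ∑ P' ∈ (univ : Finset (Fin 2)).powerset, ιq (bySize (· < 3) : Finset (Finset (Fin 2))) P * ιq (below 2 (X1 ∩ Z1)) P' * (if Disjoint P P' then (1 : ℚ) else 0))
      - (∑ P ∈ (univ : Finset (Fin 2)).powerset, ∑ P' ∈ (univ : Finset (Fin 2)).powerset, ιq (bySize (· < 2) : Finset (Finset (Fin 2))) P * ιq (below 3 (X0 ∩ Z0)) P' * (if Disjoint P P' then (1 : ℚ) else 0))
      - (∑ P ∈ (univ : Finset (Fin 2)).powerset, ∑ P' ∈ (univ : Finset (Fin 2)).powerset, ιq (bySize (· < 2) : Finset (Finset (Fin 2))) P * ιq (below 2 (X1 ∩ Z1)) P' * (if Disjoint P P' then (1 : ℚ) else 0))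
      + (∑ P ∈ (univ : Finset (Fin 2)).powerset, ∑ P' ∈ (univ : Finset (Fin 2)).powerset, ιq (below 2 X1) P * ιq (below 3 Z0) P' * (if Disjoint P P' then (1 : ℚ) else 0))
      + (∑ P ∈ (univ : Finset (Fin 2)).powerset, ∑ P' ∈ (univ : Finset (Fin 2)).powerset, ιq (below 3 X0) P * ιq (below 2 Z1) P' * (if Disjoint P P' then (1 : ℚ) else 0))
      + (∑ P ∈ (univ : Finset (Fin 2)).powerset, ∑ P' ∈ (univ : Finset (Fin 2)).powerset, ιq (below 2 X1) P * ιq (below 2 Z1) P' * (if Disjoint P P' then (1 : ℚ) else 0)) := by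
  native_decide

/-- **ROW 1 WITH EXACTLY TWO SINGLE POINTS**: up-sets, `σ = {a, b}` loop-free, `d ∉ σ`, `∅ ∉ 𝒳, 𝒵` ⇒ `coeff_{1_σ+2e_d} R_3 ≥ 0`. [this work] -/
theorem coeff_ind_add_single_two_Rt_three_nonneg_two {α : Type*} [DecidableEq α] [Fintype α] {F G : Finset (Finset α)}
    (hF : IsUpperSet (F : Set (Finset α))) (hG : IsUpperSet (G : Set (Finset α))) {σ : Finset α} {d : α} (hd : d ∉ σ) (hσ : #σ = 2)
    (h0F : ∅ ∉ F) (h0G : ∅ ∉ G) (h1F : ∀ v ∈ σ, ({v} : Finset α) ∉ F) (h1G : ∀ v ∈ σ, ({v} : Finset α) ∉ G) :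
    0 ≤ (Rt 3 F G).coeff (ind σ + Finsupp.single d 2) := by
  have hle := coeff_rowOne_ge_full hF hG hd
  suffices h : 0 ≤ atomSum (fun a b c => ∑ t ∈ range 3, (((#σ - a - b - c).choose t : ℕ) : ℚ) *
            (if b + c < #σ - t then ((((#σ - t : ℕ) : ℚ)) * ((((#σ - t - 1).choose (b + c) : ℕ) : ℚ)))⁻¹ else 0))
          (fun _ _ _ => 0) (fun _ _ _ => 0) (fun _ _ _ => 0) (fun _ _ _ => 0) (linkV d F) (linkV d G) σ
        + atomSum (fun a b c => ∑ t ∈ range 2, (((#σ - a - b - c).choose t : ℕ) : ℚ) *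
            (if b + c < #σ - t then ((((#σ - t : ℕ) : ℚ)) * ((((#σ - t - 1).choose (b + c) : ℕ) : ℚ)))⁻¹ else 0))
          (fun _ _ _ => 0) (fun _ _ _ => 0) (fun _ _ _ => 0) (fun _ _ _ => 0) (delV d F) (linkV d G) σ
        + atomSum (fun a b c => ∑ t ∈ range 2, (((#σ - a - b - c).choose t : ℕ) : ℚ) *
            (if b + c < #σ - t then ((((#σ - t : ℕ) : ℚ)) * ((((#σ - t - 1).choose (b + c) : ℕ) : ℚ)))⁻¹ else 0))
          (fun _ _ _ => 0) (fun _ _ _ => 0) (fun _ _ _ => 0) (fun _ _ _ => 0) (linkV d F) (delV d G) σ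
        + (∑ P ∈ σ.powerset, ∑ P' ∈ σ.powerset, ιq (bySize (· < 2) : Finset (Finset α)) P * ιq (below 3 (((linkV d F) ∩ (linkV d G)) \ ((delV d F) ∪ (delV d G)))) P' * (if Disjoint P P' then (1 : ℚ) else 0))
        - (∑ P ∈ σ.powerset, ∑ P' ∈ σ.powerset, ιq (bySize (· < 3) : Finset (Finset α)) P * ιq (below 2 ((linkV d F) ∩ (linkV d G))) P' * (if Disjoint P P' then (1 : ℚ) else 0))
        - (∑ P ∈ σ.powerset, ∑ P' ∈ σ.powerset, ιq (bySize (· < 2) : Finset (Finset α)) P * ιq (below 3 ((delV d F) ∩ (delV d G))) P' * (if Disjoint P P' then (1 : ℚ) else 0))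
        - (∑ P ∈ σ.powerset, ∑ P' ∈ σ.powerset, ιq (bySize (· < 2) : Finset (Finset α)) P * ιq (below 2 ((linkV d F) ∩ (linkV d G))) P' * (if Disjoint P P' then (1 : ℚ) else 0))
        + (∑ P ∈ σ.powerset, ∑ P' ∈ σ.powerset, ιq (below 2 (linkV d F)) P * ιq (below 3 (delV d G)) P' * (if Disjoint P P' then (1 : ℚ) else 0))
        + (∑ P ∈ σ.powerset, ∑ P' ∈ σ.powerset, ιq (below 3 (delV d F)) P * ιq (below 2 (linkV d G)) P' * (if Disjoint P P' then (1 : ℚ) else 0))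
        + (∑ P ∈ σ.powerset, ∑ P' ∈ σ.powerset, ιq (below 2 (linkV d F)) P * ιq (below 2 (linkV d G)) P' * (if Disjoint P P' then (1 : ℚ) else 0)) by
    exact_mod_cast h.trans hle
  -- transport to `Fin 2`
  obtain ⟨φ, hφ⟩ : ∃ φ : Fin 2 ↪ α, (univ : Finset (Fin 2)).map φ = σ := by
    let e : Fin 2 ≃ {x // x ∈ σ} := (Fintype.equivFinOfCardEq (by rw [Fintype.card_coe, hσ])).symm
    refine ⟨e.toEmbedding.trans (Function.Embedding.subtype _), ?_⟩
    ext x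
    simp only [mem_map, mem_univ, true_and, Function.Embedding.trans_apply, Equiv.coe_toEmbedding, Function.Embedding.coe_subtype]
    constructor
    · rintro ⟨i, rfl⟩; exact (e i).2
    · intro hx; exact ⟨e.symm ⟨x, hx⟩, by simp⟩
  subst hφ
  have hφσ : ∀ i : Fin 2, φ i ∈ (univ : Finset (Fin 2)).map φ := fun i => mem_map_of_mem φ (mem_univ i)
  have hnd : ∀ T : Finset (Fin 2), d ∉ T.map φ := fun T hT => by
    obtain ⟨i, _, hi⟩ := mem_map.1 hT; exact hd (hi ▸ hφσ i)
  -- the pulled-back trace data is admissible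
  have hup0 : ∀ (K : Finset (Finset α)), IsUpperSet (K : Set (Finset α)) →
      ∀ S ∈ ((univ : Finset (Fin 2)).powerset.filter fun T => T.map φ ∈ delV d K), ∀ i : Fin 2,
        insert i S ∈ ((univ : Finset (Fin 2)).powerset.filter fun T => T.map φ ∈ delV d K) := fun K hK S hS i =>
    mem_filter.2 ⟨mem_powerset.2 (subset_univ _), (mem_delV_iff_of_not_mem (hnd _)).2
      (hK (map_subset_map.2 (subset_insert i S)) ((mem_delV_iff_of_not_mem (hnd S)).1 (mem_filter.1 hS).2))⟩
  have hup1 : ∀ (K : Finset (Finset α)), IsUpperSet (K : Set (Finset α)) →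
      ∀ S ∈ ((univ : Finset (Fin 2)).powerset.filter fun T => T.map φ ∈ linkV d K), ∀ i : Fin 2,
        insert i S ∈ ((univ : Finset (Fin 2)).powerset.filter fun T => T.map φ ∈ linkV d K) := fun K hK S hS i => by
    have hSK := (mem_linkV_iff_of_not_mem (hnd S)).1 (mem_filter.1 hS).2
    rw [mem_filter] at hSK
    refine mem_filter.2 ⟨mem_powerset.2 (subset_univ _), (mem_linkV_iff_of_not_mem (hnd _)).2 (mem_filter.2 ⟨mem_powerset.2 (subset_univ _), ?_⟩)⟩
    exact hK (insert_subset_insert d (map_subset_map.2 (subset_insert i S))) hSK.2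
  have hsub : ∀ (K : Finset (Finset α)), IsUpperSet (K : Set (Finset α)) →
      ∀ S ∈ ((univ : Finset (Fin 2)).powerset.filter fun T => T.map φ ∈ delV d K), S ∈ ((univ : Finset (Fin 2)).powerset.filter fun T => T.map φ ∈ linkV d K) :=
    fun K hK S hS => mem_filter.2 ⟨mem_powerset.2 (subset_univ _), delV_subset_linkV_of_isUpperSet hK (mem_filter.1 hS).2⟩
  have htwo : ∀ (K : Finset (Finset α)), ∅ ∉ K → (∀ i : Fin 2, ({φ i} : Finset α) ∉ K) →
      ∀ S ∈ ((univ : Finset (Fin 2)).powerset.filter fun T => T.map φ ∈ delV d K), 2 ≤ #S := fun K hK0 hK1 S hS => by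
    have hSK : S.map φ ∈ K := (mem_delV_iff_of_not_mem (hnd S)).1 (mem_filter.1 hS).2
    by_contra hlt
    rcases Nat.lt_or_ge #S 1 with hS0 | hS1
    · rw [card_eq_zero.1 (show #S = 0 by omega), map_empty] at hSK; exact hK0 hSK
    · obtain ⟨i, hi⟩ := card_eq_one.1 (show #S = 1 by omega)
      rw [hi, map_singleton] at hSK; exact hK1 i hSK
  have key := full_two_nonneg _ _ _ _ (hup1 F hF) (hup0 F hF) (hsub F hF) (htwo F h0F fun i => h1F _ (hφσ i))
    (hup1 G hG) (hup0 G hG) (hsub G hG) (htwo G h0G fun i => h1G _ (hφσ i))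
  rw [atomSum_map, atomSum_map, atomSum_map]
  simp only [indPair_map, pullGen_bySize, pullGen_below, pullGen_inter, pullGen_sdiff_union, card_map, card_univ, Fintype.card_fin]
  exact key

end RtThreeFin3

namespace RtThreeFin3

open SahiCTCGenFun

/-- **ROW 1 (ONE DOUBLED POINT) FOR EVERY `σ`**: up-sets `𝒳, 𝒵`, `σ` loop-free in both, `d ∉ σ` ⇒ `coeff_{1_σ+2e_d} R_3(𝒳,𝒵) ≥ 0`
(`#σ ≥ 3`: `…RowOneProfile`; `#σ = 2`: the two-point check; `#σ ≤ 1`: the support has `≤ 2` points and the coefficient vanishes). [this work] -/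
theorem coeff_ind_add_single_two_Rt_three_nonneg_all {α : Type*} [DecidableEq α] [Fintype α] {F G : Finset (Finset α)}
    (hF : IsUpperSet (F : Set (Finset α))) (hG : IsUpperSet (G : Set (Finset α))) {σ : Finset α} {d : α} (hd : d ∉ σ)
    (h1F : ∀ v ∈ σ, ({v} : Finset α) ∉ F) (h1G : ∀ v ∈ σ, ({v} : Finset α) ∉ G) :
    0 ≤ (Rt 3 F G).coeff (ind σ + Finsupp.single d 2) := by
  by_cases h0F : ∅ ∈ F
  · rw [eq_univ_powerset_of_empty_mem hF h0F, RtThreeFin4.Rt_three_univ_powerset_left, coeff_zero]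
  by_cases h0G : ∅ ∈ G
  · rw [eq_univ_powerset_of_empty_mem hG h0G, RtThreeFin4.Rt_three_univ_powerset_right, coeff_zero]
  rcases Nat.lt_or_ge #σ 3 with hlt | hge
  · rcases Nat.lt_or_ge #σ 2 with hlt2 | hge2
    · rw [coeff_Rt_three_eq_zero_of_card_support_le_two]
      refine (card_le_card (fun i hi => ?_)).trans ((card_insert_le d σ).trans (by omega))
      rw [Finsupp.mem_support_iff, Finsupp.add_apply, ind_apply, Finsupp.single_apply] at hi
      rw [mem_insert]
      by_cases h1 : i ∈ σ
      · exact Or.inr h1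
      · by_cases h2 : d = i
        · exact Or.inl h2.symm
        · rw [if_neg h1, if_neg h2] at hi; exact absurd rfl hi
    · exact coeff_ind_add_single_two_Rt_three_nonneg_two hF hG hd (by omega) h0F h0G h1F h1G
  · exact coeff_ind_add_single_two_Rt_three_nonneg hF hG hd hge h0F h0G h1F h1G

/-- **ROW 1 IN THE SHAPE OF `hLF`, ALL PROFILES**: up-sets, entries `≤ 2`, exactly one doubled point, single points loop-free ⇒ `coeff_n R_3 ≥ 0` —
the complete `#dbl n = 1` case of `hLF` of `…RtThreeDiagonalBase.coeff_Rt_three_nonneg_of_loopFree'`. [this work] -/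
theorem coeff_Rt_three_nonneg_of_card_dbl_eq_one' {α : Type*} [DecidableEq α] [Fintype α] {F G : Finset (Finset α)}
    (hF : IsUpperSet (F : Set (Finset α))) (hG : IsUpperSet (G : Set (Finset α))) (n : α →₀ ℕ) (hn : ∀ i, n i ≤ 2) (hd : #(dbl n) = 1)
    (hl : ∀ u, n u = 1 → ({u} : Finset α) ∉ F ∧ ({u} : Finset α) ∉ G) : 0 ≤ (Rt 3 F G).coeff n := by
  obtain ⟨d, hdd⟩ := card_eq_one.1 hd
  have hd2 : n d = 2 := by
    have : d ∈ dbl n := by rw [hdd]; exact mem_singleton_self d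
    exact (mem_filter.1 this).2
  set σ := n.support.filter fun i => n i = 1 with hσdef
  have hdσ : d ∉ σ := fun h => by have := (mem_filter.1 h).2; omega
  have hnσ : n = ind σ + Finsupp.single d 2 := by
    ext i
    rw [Finsupp.add_apply, ind_apply, Finsupp.single_apply]
    by_cases hi : i ∈ σ
    · have h1 : n i = 1 := (mem_filter.1 hi).2
      have hne : d ≠ i := fun h => hdσ (h ▸ hi)
      rw [if_pos hi, if_neg hne, h1, add_zero]
    · rw [if_neg hi]
      by_cases hdi : d = i
      · subst hdi; rw [if_pos rfl, hd2, zero_add]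
      · rw [if_neg hdi]
        have hni : n i ≠ 1 := fun h => hi (mem_filter.2 ⟨Finsupp.mem_support_iff.2 (by rw [h]; exact one_ne_zero), h⟩)
        have hn2 : n i ≠ 2 := fun h => hdi (by
          have : i ∈ dbl n := mem_filter.2 ⟨Finsupp.mem_support_iff.2 (by rw [h]; norm_num), h⟩
          rw [hdd] at this; exact (mem_singleton.1 this).symm)
        have := hn i; omega
  rw [hnσ]
  exact coeff_ind_add_single_two_Rt_three_nonneg_all hF hG hdσ (fun v hv => (hl v (mem_filter.1 hv).2).1) (fun v hv => (hl v (mem_filter.1 hv).2).2)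

end RtThreeFin3

end Summit.CriticalPhenomena.PercolationContinuityZ3.Theorems.SahiCTCForms
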